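import Summits.Ventures.YMGap.Thresholds.CouplingSmooth
import Summits.Ventures.YMGap.Thresholds.PressureDerivative
import Summits.Ventures.YMGap.Thresholds.CouplingDerivativeClosed
import HarnessLib

/-!
# Venture YMGap — C-SMOOTH (iii): THE FREE ENERGY DENSITY IS `C^∞` ON THE STRONG-COUPLING WINDOW, the CLOSED window
# up to `β = 0⁺`, and THE STRONG-COUPLING EXPANSION AS AN ASYMPTOTIC SERIES TO ALL ORDERS (`SU(2)`, `d = 4`)

HONEST FRAMING: venture file of the cell `pub-ymgap` (QuantumFields programme), seat ds-1 (gen 12).  Strong-coupling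
LATTICE statements for `SU(2)` lattice Yang–Mills on `ℤ^4` with the Wilson action on the one-state window (tree coupling
`β = β_W/2`, `0 ≤ β ≤ 9/50`, Wilson `0 ≤ β_W ≤ 9/25`): (§1) the infinite-volume free energy density
`f = freeEnergyDensity 4 ρ_{SU(2)}` is `C^∞` on the OPEN window `(0, 9/50)`; (§2–§3) the state map `β_W ↦ ⟨F⟩_{β_W}` is
`C^∞` on the CLOSED window `[0, β₁]` in the one-sided sense (derivatives WITHIN the interval), every right-derivative at
`β_W = 0` being the order-`n` response series AT THE `β = 0` STATE; (§4) `f ∈ C^∞[0, 9/50]` and Taylor's theorem turns this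
into THE STRONG-COUPLING (Balian–Drouffe–Itzykson) EXPANSION AS AN ASYMPTOTIC SERIES TO EVERY ORDER with remainder
`C_n β^{n+1}`.  `C^∞` / asymptotic, NOT analytic / convergent; the window is where the vertex-star bound closes, not a
transition; NO FINITE-ORDER TRANSITION inside the window; nothing about the continuum, confinement at weak coupling, or
the Clay problem.  Closes the C-PRESS ladder (`C¹`/`C^{1,1}` g9, `C²` g9, `C³`/`C⁴` g10 staged) in one theorem.
Mechanism: `f' = −e(μ_β) = −Σ_{i<j} (2 − ⟨Re tr U_{p_ij}⟩_{μ β})` on the closed window (g9 `su2_hasDerivWithinAt_freeEnergyDensity`,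
`su2_hasDerivAt_freeEnergyDensity`) + this seat's `C^∞` of the state (`su2_contDiffOn_infty_plaquette_9_25`); for the closed
window: continuity of every truncated function (`continuousOn_ac` + C-LIP-STAR `su2_continuousOn_integral`) and of the
response series (uniform tree-decay domination, `continuousOn_tsum`), FTC-2 on `[0, t]` + FTC-1 at a point of the closed
interval (g8's `hasDerivWithinAt_of_intervalIntegral_eq`), `contDiffOn_succ_iff_derivWithin`; Mathlib `taylor_mean_remainder_bound`.

* ★★★ `su2_contDiffOn_infty_freeEnergyDensity` — `ContDiffOn ℝ ∞ f (Ioo 0 (9/50))`; `su2_contDiffOn_nat_freeEnergyDensity`;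
* `su2_continuousOn_trunc` / `su2_continuousOn_truncSum` — `u_{n+1}` and `R_n` are continuous on `[0, β₁]`;
* ★ `su2_hasDerivWithinAt_truncSum_Icc` — `R_n' = R_{n+1}` WITHIN `[0, β₁]`, `β_W = 0` included;
* ★★ `su2_contDiffOn_infty_integral_Icc` — `β_W ↦ ⟨F⟩_{β_W}` is `ContDiffOn ℝ ∞` on `Icc 0 β₁` (`0 < β₁ ≤ 9/25`);
* ★★ `su2_iteratedDerivWithin_integral_eq` / `_zero` — `iteratedDerivWithin n ⟨F⟩ [0, β₁] β_W = R_n(β_W)`; at `β_W = 0` the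
  `n`-th right-derivative is `Σ_q u_{n+1}(F; W_{q 0}; …)` under the `β = 0` DLR state (finite-range cumulant sums of
  independent Haar links — the BDI coefficients of `⟨F⟩`, values not computed here);
* ★★★ `su2_contDiffOn_infty_freeEnergyDensity_Icc` — `f ∈ C^∞[0, 9/50]` (one-sided at the ends);
* ★★★ `su2_freeEnergyDensity_taylor_all_orders` — `∀ n ∃ C ∀ β ∈ [0, 9/50], |f β − taylorWithinEval f n [0,9/50] 0 β| ≤ C β^{n+1}`:
  the strong-coupling expansion is asymptotic to all orders, coefficients = the right-derivatives `f^{(k)}(0⁺)/k!`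
  (g9–g11: `f'(0⁺) = −12`, `f'' = 6`, `f‴ = 0`, `f⁗ = −6`).

References (mechanism only): S. Friedli, Y. Velenik, *Statistical Mechanics of Lattice Systems* (2017), Prop. 6.91;
R. Balian, J.-M. Drouffe, C. Itzykson, PRD 11 (1975) 2104 (the expansion; coefficients not used); K. Osterwalder,
E. Seiler, Ann. Phys. 110 (1978) 440 (analyticity by cluster expansion on a smaller window — a different statement, not
used); M. Duneau, D. Iagolnitzer, B. Souillard, CMP 31 (1973) 191.
-/

noncomputable section

open MeasureTheory ProbabilityTheory Function Finset Filter Topology Real Set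
open scoped NNReal ContDiff
open Literature.MathematicalPhysics.QuantumLattice (LGConfig ZdEdge ZdPlaquette plaquetteEdges fundamentalRep
  ymGibbsMeasures plaquetteObs freeEnergyDensity)
open Literature.MathematicalPhysics.QuantumFieldTheory hiding ZdEdge
open Literature.Probability.LatticeModels (Site Site.supNorm Site.norm_eq_supNorm)
open Summit.Ventures.YMGap.RobustBall (l1 numOrient)
open Summit.Ventures.YMGap.Cumulants

/-! ### §1 The free energy density is `C^∞` on the open window -/

namespace Summit.Ventures.YMGap.PressureRegularity

open Summit.Ventures.YMGap.CouplingResponse (exists_dlrSelection su2_contDiffOn_infty_plaquette_9_25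
  plaquetteObs_fundamentalRep_eq_mul_zdPlaquetteObs)

/-- Local shorthand: the planes `{(i, j) : i < j}` of `ℤ⁴`. -/
local notation3 (prettyPrint := false) "𝔓₄" => {q : Fin 4 × Fin 4 // q.1 < q.2}

/-- **Each plane plaquette expectation is `C^∞` in the TREE coupling on `(0, 9/50)`** along the tree-coupling
selection `t ↦ μ (2t)` of a `β_W`-indexed DLR selection `μ` (`β_W = 2t`; `Re tr = 2 W`). -/
theorem su2_contDiffOn_infty_plaquette_tree
    {μ : ℝ → Measure (LGConfig 4 (Matrix.specialUnitaryGroup (Fin 2) ℂ))}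
    (hμ : ∀ βW : ℝ, μ βW ∈ ymGibbsMeasures (d := 4) (fundamentalRep (Fin 2)) (2 * (βW / 4))) (q : 𝔓₄) :
    ContDiffOn ℝ ∞ (fun t => ∫ U, plaquetteObs (fundamentalRep (Fin 2)) 0 q.1.1 q.1.2 U ∂(μ (2 * t)))
      (Ioo (0 : ℝ) (9 / 50)) := by
  have hμW : ∀ βW ∈ Icc (0 : ℝ) (9 / 25),
      μ βW ∈ ymGibbsMeasures (d := 4) (fundamentalRep (Fin 2)) (2 * (βW / 4)) := fun βW _ => hμ βW
  have hC := su2_contDiffOn_infty_plaquette_9_25 hμW ((0 : Literature.Probability.LatticeModels.Site 4), q)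
  have hlin : ContDiffOn ℝ ∞ (fun t : ℝ => 2 * t) (Ioo (0 : ℝ) (9 / 50)) :=
    (contDiff_const.mul contDiff_id).contDiffOn
  have hmaps : MapsTo (fun t : ℝ => 2 * t) (Ioo (0 : ℝ) (9 / 50)) (Ioo (0 : ℝ) (9 / 25)) :=
    fun t ht => ⟨by linarith [ht.1], by linarith [ht.2]⟩
  have hcomp := hC.comp hlin hmaps
  have hscale : (fun t => ∫ U, plaquetteObs (fundamentalRep (Fin 2)) 0 q.1.1 q.1.2 U ∂(μ (2 * t))) =
      fun t => 2 * ((fun s => ∫ U, zdPlaquetteObs (fundamentalRep (Fin 2))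
        (0 : Literature.Probability.LatticeModels.Site 4) q.1.1 q.1.2 U ∂(μ s)) ∘ fun t : ℝ => 2 * t) t := by
    funext t
    simp only [Function.comp_def]
    rw [← integral_const_mul]
    refine integral_congr_ae (ae_of_all _ fun U => ?_)
    rw [plaquetteObs_fundamentalRep_eq_mul_zdPlaquetteObs]
    norm_num
  rw [hscale]
  exact contDiffOn_const.mul hcomp

/-- ★★★ **THE FREE ENERGY DENSITY IS `C^∞` ON THE OPEN STRONG-COUPLING WINDOW** (`SU(2)`, `d = 4`, hypothesis-free):
`ContDiffOn ℝ ∞ (freeEnergyDensity 4 ρ_{SU(2)}) (Ioo 0 (9/50))` — `f' = −Σ_{i<j} (2 − ⟨Re tr U_{p_ij}⟩_{μ β})`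
(g9) with every mean plaquette `C^∞` in the coupling (`su2_contDiffOn_infty_plaquette_tree`).  NO FINITE-ORDER
TRANSITION inside the window; `C^∞`, NOT analytic. -/
theorem su2_contDiffOn_infty_freeEnergyDensity :
    ContDiffOn ℝ ∞ (freeEnergyDensity 4 (fundamentalRep (Fin 2))) (Ioo (0 : ℝ) (9 / 50)) := by
  obtain ⟨μ, hμ⟩ := exists_dlrSelection
  have hμsel : ∀ t ∈ Icc (0 : ℝ) (9 / 50), μ (2 * t) ∈ ymGibbsMeasures (d := 4) (fundamentalRep (Fin 2)) t := by
    intro t _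
    have h := hμ (2 * t)
    rwa [show (2 : ℝ) * (2 * t / 4) = t by ring] at h
  rw [contDiffOn_infty_iff_deriv_of_isOpen isOpen_Ioo]
  refine ⟨su2_differentiableOn_freeEnergyDensity, ?_⟩
  have hrhs : ContDiffOn ℝ ∞
      (fun t => -∑ q : 𝔓₄, ((2 : ℝ) - ∫ U, plaquetteObs (fundamentalRep (Fin 2)) 0 q.1.1 q.1.2 U ∂(μ (2 * t))))
      (Ioo (0 : ℝ) (9 / 50)) :=
    (ContDiffOn.sum fun q _ => contDiffOn_const.sub (su2_contDiffOn_infty_plaquette_tree hμ q)).neg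
  refine hrhs.congr fun t ht => ?_
  exact (su2_hasDerivAt_freeEnergyDensity hμsel ht).deriv

/-- ★ **`f ∈ Cⁿ` on the open window for every `n`** — supersedes the `C²` (g9), `C³`, `C⁴` (g10) rows there. -/
theorem su2_contDiffOn_nat_freeEnergyDensity (n : ℕ) :
    ContDiffOn ℝ n (freeEnergyDensity 4 (fundamentalRep (Fin 2))) (Ioo (0 : ℝ) (9 / 50)) :=
  contDiffOn_infty.1 su2_contDiffOn_infty_freeEnergyDensity n

end Summit.Ventures.YMGap.PressureRegularity

namespace Summit.Ventures.YMGap.CouplingResponse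

/-- Local shorthand: the normalised plaquette observable `W_q = ½ Re tr U_q` of `SU(2)` on `ℤ⁴`, as a family. -/
local notation3 (prettyPrint := false) "𝓦" =>
  fun q : ZdPlaquette 4 => zdPlaquetteObs (d := 4) (fundamentalRep (Fin 2)) (Prod.fst q) (Prod.snd q).1.1 (Prod.snd q).1.2

/-! ### §2 Continuity of the truncated functions and of the response series on the closed window -/

/-- **Every truncated function is continuous in the coupling on `[0, β₁]`** (`β₁ ≤ 9/25`, any DLR selection): the moments
of the slot family are continuous by C-LIP-STAR (`su2_continuousOn_integral`), and `ac` is a polynomial in them. -/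
theorem su2_continuousOn_trunc {β₁ : ℝ} (h1 : β₁ ≤ 9 / 25)
    {μ : ℝ → Measure (LGConfig 4 (Matrix.specialUnitaryGroup (Fin 2) ℂ))}
    (hμ : ∀ βW ∈ Icc (0 : ℝ) β₁, μ βW ∈ ymGibbsMeasures (d := 4) (fundamentalRep (Fin 2)) (2 * (βW / 4)))
    {F : LGConfig 4 (Matrix.specialUnitaryGroup (Fin 2) ℂ) → ℝ} {Λ : Finset (ZdEdge 4)} {K : ℝ≥0}
    (hF : IsLipschitzCylinder (fundamentalRep (Fin 2)) F Λ K)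
    {x₀ : Site 4} {D : ℕ} (hD : ∀ e ∈ Λ, ‖e.1 - x₀‖ ≤ D) {n : ℕ} (q : Fin n → ZdPlaquette 4) :
    ContinuousOn (fun t => trunc (μ t) F 𝓦 q) (Icc (0 : ℝ) β₁) := by
  classical
  choose ΛT KT MT DT hLT hMT hDT using su2_slots_prod hF hD q
  exact continuousOn_ac (m := fun t T => mom (μ t) (slots F 𝓦 q) T) (S := Finset.range (n + 1))
    (fun T _ => su2_continuousOn_integral h1 hμ (hLT T) (hDT T)) 0 _ subset_rfl

/-- **The order-`n` response series is continuous on `[0, β₁]`**: termwise continuity and the uniform tree-decay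
domination `|u_{n+1}(F; W_q…)| ≤ A ∏_i ρ^{‖x₀ − x_{q i}‖₁}` (`continuousOn_tsum`). -/
theorem su2_continuousOn_truncSum {β₁ : ℝ} (h1 : β₁ ≤ 9 / 25)
    {μ : ℝ → Measure (LGConfig 4 (Matrix.specialUnitaryGroup (Fin 2) ℂ))}
    (hμ : ∀ βW ∈ Icc (0 : ℝ) β₁, μ βW ∈ ymGibbsMeasures (d := 4) (fundamentalRep (Fin 2)) (2 * (βW / 4)))
    {F : LGConfig 4 (Matrix.specialUnitaryGroup (Fin 2) ℂ) → ℝ} {Λ : Finset (ZdEdge 4)} {K : ℝ≥0}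
    (hF : IsLipschitzCylinder (fundamentalRep (Fin 2)) F Λ K)
    {x₀ : Site 4} {D : ℕ} (hD : ∀ e ∈ Λ, ‖e.1 - x₀‖ ≤ D) (n : ℕ) :
    ContinuousOn (fun t => ∑' q : Fin n → ZdPlaquette 4, trunc (μ t) F 𝓦 q) (Icc (0 : ℝ) β₁) := by
  classical
  obtain ⟨A, ρ, hA0, hρ0, hρ1, h⟩ := su2_exists_truncated_tree_bound h1 hF hD n
  set u : (Fin n → ZdPlaquette 4) → ℝ := fun q => A * ∏ i, ρ ^ l1 (x₀ - (q i).1) with hu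
  have hu0 : ∀ q, 0 ≤ u q := fun q => mul_nonneg hA0 (Finset.prod_nonneg fun i _ => pow_nonneg hρ0 _)
  have hus : Summable u :=
    (summable_pi_of_abs_le_prod (f := u) hA0 (fun r => pow_nonneg hρ0 _) (sum_pow_l1_plaquette_le hρ0 hρ1 x₀)
      (fun q => by rw [abs_of_nonneg (hu0 q)])).1
  refine continuousOn_tsum (fun q => su2_continuousOn_trunc h1 hμ hF hD q) hus fun q t ht => ?_
  rw [Real.norm_eq_abs]
  exact h ht.1 ht.2 (hμ t ht) q

/-! ### §3 The integrated identity and one-sided derivatives on the closed window -/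

/-- **FTC on `[0, t]`**: `∫_0^t R_{n+1} = R_n(t) − R_n(0)` for every `t ∈ [0, β₁]` (open-window derivatives
`su2_hasDerivAt_truncSum`, continuity on the closed window). -/
theorem su2_truncSum_integral_eq {β₁ : ℝ} (h1 : β₁ ≤ 9 / 25)
    {μ : ℝ → Measure (LGConfig 4 (Matrix.specialUnitaryGroup (Fin 2) ℂ))}
    (hμ : ∀ βW ∈ Icc (0 : ℝ) β₁, μ βW ∈ ymGibbsMeasures (d := 4) (fundamentalRep (Fin 2)) (2 * (βW / 4)))
    {F : LGConfig 4 (Matrix.specialUnitaryGroup (Fin 2) ℂ) → ℝ} {Λ : Finset (ZdEdge 4)} {K : ℝ≥0}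
    (hF : IsLipschitzCylinder (fundamentalRep (Fin 2)) F Λ K)
    {x₀ : Site 4} {D : ℕ} (hD : ∀ e ∈ Λ, ‖e.1 - x₀‖ ≤ D) (n : ℕ) {t : ℝ} (ht : t ∈ Icc (0 : ℝ) β₁) :
    ∫ s in (0 : ℝ)..t, (∑' q : Fin (n + 1) → ZdPlaquette 4, trunc (μ s) F 𝓦 q) =
      (∑' q : Fin n → ZdPlaquette 4, trunc (μ t) F 𝓦 q) - ∑' q : Fin n → ZdPlaquette 4, trunc (μ 0) F 𝓦 q := by
  have hμt : ∀ βW ∈ Icc (0 : ℝ) t, μ βW ∈ ymGibbsMeasures (d := 4) (fundamentalRep (Fin 2)) (2 * (βW / 4)) :=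
    fun βW hb => hμ βW ⟨hb.1, hb.2.trans ht.2⟩
  have h1t : t ≤ 9 / 25 := ht.2.trans h1
  refine intervalIntegral.integral_eq_sub_of_hasDerivAt_of_le ht.1 (su2_continuousOn_truncSum h1t hμt hF hD n)
    (fun s hs => su2_hasDerivAt_truncSum h1t hμt hF hD n hs) ?_
  exact ((su2_continuousOn_truncSum h1t hμt hF hD (n + 1)).mono (by rw [Set.uIcc_of_le ht.1])).intervalIntegrable

/-- ★ **`R_n' = R_{n+1}` WITHIN THE CLOSED WINDOW, `β_W = 0` INCLUDED**: for `β₁ ≤ 9/25`, any DLR selection on `[0, β₁]`,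
every Lipschitz cylinder `F`, every `n` and every `β_W ∈ [0, β₁]`:
`HasDerivWithinAt R_n (R_{n+1}(β_W)) [0, β₁] β_W` — at `β_W = 0` the right-derivative at the `β = 0` state. -/
theorem su2_hasDerivWithinAt_truncSum_Icc {β₁ : ℝ} (h1 : β₁ ≤ 9 / 25)
    {μ : ℝ → Measure (LGConfig 4 (Matrix.specialUnitaryGroup (Fin 2) ℂ))}
    (hμ : ∀ βW ∈ Icc (0 : ℝ) β₁, μ βW ∈ ymGibbsMeasures (d := 4) (fundamentalRep (Fin 2)) (2 * (βW / 4)))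
    {F : LGConfig 4 (Matrix.specialUnitaryGroup (Fin 2) ℂ) → ℝ} {Λ : Finset (ZdEdge 4)} {K : ℝ≥0}
    (hF : IsLipschitzCylinder (fundamentalRep (Fin 2)) F Λ K)
    {x₀ : Site 4} {D : ℕ} (hD : ∀ e ∈ Λ, ‖e.1 - x₀‖ ≤ D) (n : ℕ) {βW : ℝ} (hb : βW ∈ Icc (0 : ℝ) β₁) :
    HasDerivWithinAt (fun t => ∑' q : Fin n → ZdPlaquette 4, trunc (μ t) F 𝓦 q)
      (∑' q : Fin (n + 1) → ZdPlaquette 4, trunc (μ βW) F 𝓦 q) (Icc (0 : ℝ) β₁) βW :=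
  hasDerivWithinAt_of_intervalIntegral_eq (fun _ ht => su2_truncSum_integral_eq h1 hμ hF hD n ht)
    (su2_continuousOn_truncSum h1 hμ hF hD (n + 1)) hb

/-! ### §4 `C^∞` on the closed window; the right-derivatives at `β = 0` -/

/-- ★★ **THE STATE IS `C^∞` ON THE CLOSED WINDOW** (`SU(2)`, `d = 4`, hypothesis-free): for `0 < β₁ ≤ 9/25`, any DLR
selection `μ` on `[0, β₁]` and every Lipschitz cylinder `F`, `β_W ↦ ⟨F⟩_{μ β_W}` is `ContDiffOn ℝ ∞` on `Icc 0 β₁`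
(derivatives within the interval; one-sided at `0` and `β₁`). -/
theorem su2_contDiffOn_infty_integral_Icc {β₁ : ℝ} (h0 : 0 < β₁) (h1 : β₁ ≤ 9 / 25)
    {μ : ℝ → Measure (LGConfig 4 (Matrix.specialUnitaryGroup (Fin 2) ℂ))}
    (hμ : ∀ βW ∈ Icc (0 : ℝ) β₁, μ βW ∈ ymGibbsMeasures (d := 4) (fundamentalRep (Fin 2)) (2 * (βW / 4)))
    {F : LGConfig 4 (Matrix.specialUnitaryGroup (Fin 2) ℂ) → ℝ} {Λ : Finset (ZdEdge 4)} {K : ℝ≥0}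
    (hF : IsLipschitzCylinder (fundamentalRep (Fin 2)) F Λ K)
    {x₀ : Site 4} {D : ℕ} (hD : ∀ e ∈ Λ, ‖e.1 - x₀‖ ≤ D) :
    ContDiffOn ℝ ∞ (fun t => ∫ U, F U ∂(μ t)) (Icc (0 : ℝ) β₁) := by
  classical
  have hU : UniqueDiffOn ℝ (Icc (0 : ℝ) β₁) := uniqueDiffOn_Icc h0
  set R : ℕ → ℝ → ℝ := fun n t => ∑' q : Fin n → ZdPlaquette 4, trunc (μ t) F 𝓦 q with hR
  have hderiv : ∀ n, ∀ t ∈ Icc (0 : ℝ) β₁, HasDerivWithinAt (R n) (R (n + 1) t) (Icc (0 : ℝ) β₁) t :=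
    fun n t ht => su2_hasDerivWithinAt_truncSum_Icc h1 hμ hF hD n ht
  have hall : ∀ N : ℕ, ∀ n, ContDiffOn ℝ N (R n) (Icc (0 : ℝ) β₁) := by
    intro N
    induction N with
    | zero =>
      intro n
      exact contDiffOn_zero.2 fun t ht => (hderiv n t ht).continuousWithinAt
    | succ N ih =>
      intro n
      rw [show ((N + 1 : ℕ) : WithTop ℕ∞) = (N : WithTop ℕ∞) + 1 by push_cast; rfl,
        contDiffOn_succ_iff_derivWithin hU]
      refine ⟨fun t ht => (hderiv n t ht).differentiableWithinAt, fun h => absurd h (by simp), ?_⟩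
      exact (ih (n + 1)).congr fun t ht => (hderiv n t ht).derivWithin (hU t ht)
  have hR0 : ∀ t, R 0 t = ∫ U, F U ∂(μ t) := fun t => tsum_trunc_fin_zero (μ t) F _
  exact (contDiffOn_infty.2 fun N => hall N 0).congr fun t _ => (hR0 t).symm

/-- ★★ **THE ITERATED DERIVATIVES WITHIN THE CLOSED WINDOW ARE THE RESPONSE SERIES**: for `0 < β₁ ≤ 9/25`, any DLR
selection, every Lipschitz cylinder `F`, every `n` and every `β_W ∈ [0, β₁]`:
`iteratedDerivWithin n (β_W ↦ ⟨F⟩_{μ β_W}) [0, β₁] β_W = Σ_{q : Fin n → plaquettes} u_{n+1}(F; W_{q 0}; …)_{μ β_W}`. -/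
theorem su2_iteratedDerivWithin_integral_eq {β₁ : ℝ} (h0 : 0 < β₁) (h1 : β₁ ≤ 9 / 25)
    {μ : ℝ → Measure (LGConfig 4 (Matrix.specialUnitaryGroup (Fin 2) ℂ))}
    (hμ : ∀ βW ∈ Icc (0 : ℝ) β₁, μ βW ∈ ymGibbsMeasures (d := 4) (fundamentalRep (Fin 2)) (2 * (βW / 4)))
    {F : LGConfig 4 (Matrix.specialUnitaryGroup (Fin 2) ℂ) → ℝ} {Λ : Finset (ZdEdge 4)} {K : ℝ≥0}
    (hF : IsLipschitzCylinder (fundamentalRep (Fin 2)) F Λ K)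
    {x₀ : Site 4} {D : ℕ} (hD : ∀ e ∈ Λ, ‖e.1 - x₀‖ ≤ D) (n : ℕ) :
    ∀ ⦃βW : ℝ⦄, βW ∈ Icc (0 : ℝ) β₁ →
      iteratedDerivWithin n (fun t => ∫ U, F U ∂(μ t)) (Icc (0 : ℝ) β₁) βW =
        ∑' q : Fin n → ZdPlaquette 4, trunc (μ βW) F 𝓦 q := by
  have hU : UniqueDiffOn ℝ (Icc (0 : ℝ) β₁) := uniqueDiffOn_Icc h0
  induction n with
  | zero =>
    intro βW _
    rw [iteratedDerivWithin_zero, tsum_trunc_fin_zero]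
  | succ n ih =>
    intro βW hb
    rw [iteratedDerivWithin_succ, derivWithin_congr (fun t ht => ih ht) (ih hb)]
    exact (su2_hasDerivWithinAt_truncSum_Icc h1 hμ hF hD n hb).derivWithin (hU βW hb)

/-- ★★ **THE RIGHT-DERIVATIVES OF THE STATE AT THE STRONG-COUPLING END `β = 0`**: the `n`-th derivative within `[0, β₁]`
at `β_W = 0` of `β_W ↦ ⟨F⟩_{β_W}` is `Σ_q u_{n+1}(F; W_{q 0}; …; W_{q (n−1)})` under the `β = 0` DLR state `μ 0` (the
product Haar state; these are finite-range sums of joint cumulants of independent links — the Balian–Drouffe–Itzykson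
coefficients of `⟨F⟩`, whose VALUES are g9–g11's business, not this file's). -/
theorem su2_iteratedDerivWithin_integral_zero {β₁ : ℝ} (h0 : 0 < β₁) (h1 : β₁ ≤ 9 / 25)
    {μ : ℝ → Measure (LGConfig 4 (Matrix.specialUnitaryGroup (Fin 2) ℂ))}
    (hμ : ∀ βW ∈ Icc (0 : ℝ) β₁, μ βW ∈ ymGibbsMeasures (d := 4) (fundamentalRep (Fin 2)) (2 * (βW / 4)))
    {F : LGConfig 4 (Matrix.specialUnitaryGroup (Fin 2) ℂ) → ℝ} {Λ : Finset (ZdEdge 4)} {K : ℝ≥0}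
    (hF : IsLipschitzCylinder (fundamentalRep (Fin 2)) F Λ K)
    {x₀ : Site 4} {D : ℕ} (hD : ∀ e ∈ Λ, ‖e.1 - x₀‖ ≤ D) (n : ℕ) :
    iteratedDerivWithin n (fun t => ∫ U, F U ∂(μ t)) (Icc (0 : ℝ) β₁) 0 =
      ∑' q : Fin n → ZdPlaquette 4, trunc (μ 0) F 𝓦 q :=
  su2_iteratedDerivWithin_integral_eq h0 h1 hμ hF hD n (left_mem_Icc.2 h0.le)

end Summit.Ventures.YMGap.CouplingResponse

/-! ### §5 The free energy density on the closed window; the strong-coupling expansion as an asymptotic series -/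

namespace Summit.Ventures.YMGap.PressureRegularity

open Summit.Ventures.YMGap.CouplingResponse (exists_dlrSelection su2_contDiffOn_infty_integral_Icc
  plaquetteObs_fundamentalRep_eq_mul_zdPlaquetteObs)

/-- Local shorthand: the planes `{(i, j) : i < j}` of `ℤ⁴`. -/
local notation3 (prettyPrint := false) "𝔓₄" => {q : Fin 4 × Fin 4 // q.1 < q.2}

/-- **Each plane plaquette expectation is `C^∞` in the tree coupling on the CLOSED window `[0, 9/50]`** along the
tree-coupling selection `t ↦ μ (2t)` of a `β_W`-indexed DLR selection `μ`. -/
theorem su2_contDiffOn_infty_plaquette_tree_Icc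
    {μ : ℝ → Measure (LGConfig 4 (Matrix.specialUnitaryGroup (Fin 2) ℂ))}
    (hμ : ∀ βW : ℝ, μ βW ∈ ymGibbsMeasures (d := 4) (fundamentalRep (Fin 2)) (2 * (βW / 4))) (q : 𝔓₄) :
    ContDiffOn ℝ ∞ (fun t => ∫ U, plaquetteObs (fundamentalRep (Fin 2)) 0 q.1.1 q.1.2 U ∂(μ (2 * t)))
      (Icc (0 : ℝ) (9 / 50)) := by
  have hμW : ∀ βW ∈ Icc (0 : ℝ) (9 / 25),
      μ βW ∈ ymGibbsMeasures (d := 4) (fundamentalRep (Fin 2)) (2 * (βW / 4)) := fun βW _ => hμ βW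
  have hC := su2_contDiffOn_infty_integral_Icc (by norm_num) le_rfl hμW
    (isLipschitzCylinder_zdPlaquetteObs (N := 2) (0 : Literature.Probability.LatticeModels.Site 4) q.2)
    (x₀ := 0) (D := 1) (fun e he => by simpa using norm_fst_sub_le_of_mem_plaquetteEdges he)
  have hlin : ContDiffOn ℝ ∞ (fun t : ℝ => 2 * t) (Icc (0 : ℝ) (9 / 50)) :=
    (contDiff_const.mul contDiff_id).contDiffOn
  have hmaps : MapsTo (fun t : ℝ => 2 * t) (Icc (0 : ℝ) (9 / 50)) (Icc (0 : ℝ) (9 / 25)) :=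
    fun t ht => ⟨by linarith [ht.1], by linarith [ht.2]⟩
  have hcomp := hC.comp hlin hmaps
  have hscale : (fun t => ∫ U, plaquetteObs (fundamentalRep (Fin 2)) 0 q.1.1 q.1.2 U ∂(μ (2 * t))) =
      fun t => 2 * ((fun s => ∫ U, zdPlaquetteObs (fundamentalRep (Fin 2))
        (0 : Literature.Probability.LatticeModels.Site 4) q.1.1 q.1.2 U ∂(μ s)) ∘ fun t : ℝ => 2 * t) t := by
    funext t
    simp only [Function.comp_def]
    rw [← integral_const_mul]
    refine integral_congr_ae (ae_of_all _ fun U => ?_)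
    rw [plaquetteObs_fundamentalRep_eq_mul_zdPlaquetteObs]
    norm_num
  rw [hscale]
  exact contDiffOn_const.mul hcomp

/-- ★★★ **THE FREE ENERGY DENSITY IS `C^∞` ON THE CLOSED STRONG-COUPLING WINDOW `[0, 9/50]`** (`SU(2)`, `d = 4`,
hypothesis-free; one-sided at the ends): `ContDiffOn ℝ ∞ (freeEnergyDensity 4 ρ_{SU(2)}) (Icc 0 (9/50))` — g9's
closed-window `f' = −e(μ_β)` (`su2_hasDerivWithinAt_freeEnergyDensity`) with every mean plaquette `C^∞` up to `β = 0⁺`. -/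
theorem su2_contDiffOn_infty_freeEnergyDensity_Icc :
    ContDiffOn ℝ ∞ (freeEnergyDensity 4 (fundamentalRep (Fin 2))) (Icc (0 : ℝ) (9 / 50)) := by
  obtain ⟨μ, hμ⟩ := exists_dlrSelection
  have hμsel : ∀ t ∈ Icc (0 : ℝ) (9 / 50), μ (2 * t) ∈ ymGibbsMeasures (d := 4) (fundamentalRep (Fin 2)) t := by
    intro t _
    have h := hμ (2 * t)
    rwa [show (2 : ℝ) * (2 * t / 4) = t by ring] at h
  have hU : UniqueDiffOn ℝ (Icc (0 : ℝ) (9 / 50)) := uniqueDiffOn_Icc (by norm_num)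
  rw [contDiffOn_infty_iff_derivWithin hU]
  refine ⟨fun t ht => (su2_hasDerivWithinAt_freeEnergyDensity hμsel ht).differentiableWithinAt, ?_⟩
  have hrhs : ContDiffOn ℝ ∞
      (fun t => -∑ q : 𝔓₄, ((2 : ℝ) - ∫ U, plaquetteObs (fundamentalRep (Fin 2)) 0 q.1.1 q.1.2 U ∂(μ (2 * t))))
      (Icc (0 : ℝ) (9 / 50)) :=
    (ContDiffOn.sum fun q _ => contDiffOn_const.sub (su2_contDiffOn_infty_plaquette_tree_Icc hμ q)).neg
  refine hrhs.congr fun t ht => ?_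
  exact (su2_hasDerivWithinAt_freeEnergyDensity hμsel ht).derivWithin (hU t ht)

/-- ★★★ **THE STRONG-COUPLING EXPANSION IS AN ASYMPTOTIC SERIES TO ALL ORDERS** (`SU(2)`, `d = 4`, hypothesis-free):
for every `n` there is a constant `C` such that for all `β ∈ [0, 9/50]`
`|f(β) − taylorWithinEval f n [0, 9/50] 0 β| ≤ C β^{n+1}`,
where the Taylor polynomial is built from the right-derivatives `f^{(k)}(0⁺)` (`iteratedDerivWithin k f [0, 9/50] 0`),
the Balian–Drouffe–Itzykson coefficients (g9–g11: `f'(0⁺) = −12`, `f''(0) = 6`, `f‴(0) = 0`, `f⁗(0) = −6`).  Asymptotic,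
NOT convergent; nothing about `β > 9/50`. (Mathlib `taylor_mean_remainder_bound` on the compact window.) -/
theorem su2_freeEnergyDensity_taylor_all_orders (n : ℕ) :
    ∃ C : ℝ, ∀ β ∈ Icc (0 : ℝ) (9 / 50),
      |freeEnergyDensity 4 (fundamentalRep (Fin 2)) β -
          taylorWithinEval (freeEnergyDensity 4 (fundamentalRep (Fin 2))) n (Icc (0 : ℝ) (9 / 50)) 0 β| ≤
        C * β ^ (n + 1) := by
  have hf := su2_contDiffOn_infty_freeEnergyDensity_Icc
  have hfn : ContDiffOn ℝ (n + 1) (freeEnergyDensity 4 (fundamentalRep (Fin 2))) (Icc (0 : ℝ) (9 / 50)) :=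
    hf.of_le (by exact_mod_cast le_top)
  -- the `(n+1)`-st derivative within the window is continuous on the compact window, hence bounded
  have hcont : ContinuousOn (iteratedDerivWithin (n + 1) (freeEnergyDensity 4 (fundamentalRep (Fin 2)))
      (Icc (0 : ℝ) (9 / 50))) (Icc (0 : ℝ) (9 / 50)) :=
    hf.continuousOn_iteratedDerivWithin (by exact_mod_cast le_top) (uniqueDiffOn_Icc (by norm_num))
  obtain ⟨C, hC⟩ := (isCompact_Icc.image_of_continuousOn hcont).isBounded.exists_norm_le
  refine ⟨C / n.factorial, fun β hβ => ?_⟩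
  have h := taylor_mean_remainder_bound (f := freeEnergyDensity 4 (fundamentalRep (Fin 2))) (a := 0) (b := 9 / 50)
    (n := n) (by norm_num) hfn hβ (fun y hy => hC _ (Set.mem_image_of_mem _ hy))
  rw [sub_zero] at h
  rw [Real.norm_eq_abs] at h
  calc _ ≤ C * β ^ (n + 1) / n.factorial := h
    _ = C / n.factorial * β ^ (n + 1) := by ring

end Summit.Ventures.YMGap.PressureRegularity

end
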